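import Summits.ResolutionOfSingularities.ResolutionOfSingularities.Theorems.FrobeniusClosingPatchingRelPerfectConeCubeLevelTwo
import Summits.ResolutionOfSingularities.ResolutionOfSingularities.Theorems.FrobeniusClosingPatchingRelPerfectConeCubeSide
import Summits.ResolutionOfSingularities.ResolutionOfSingularities.Theorems.FrobeniusClosingPatchingRelPerfectConeCubeVertexCone
import Summits.ResolutionOfSingularities.ResolutionOfSingularities.Theorems.FrobeniusClosingPatchingRelPerfectConeDepthTwo
import Literature.AlgebraicGeometry.Resolution.BlowupPointSubalgebra
import HarnessLib

/-!
# Crux `PatchingRelPerfect` (stmt-ResolutionOfSingularities-16161), chain w52 — the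
# CONTACT-MIGRATION member `(x₀x₁ + x₂² + x₃³) + 𝔪⁴ ∈ 𝒞`, kernel-checked

[OURS · L1 W5.2 · rung] Kernel sentence (iii) at exceptional depth two over the quadric cone
`q = x₀x₁ + x₂²`, the one NON-permissible tilt direction (this seat's HAND-NOTE-nongraded-A2.md and
PLAN-A2-certificate.md): `f = q + x₃³`, `I = (f) + 𝔪⁴`, `S` regular local of dimension four with
regular system of parameters `x₀, …, x₃` (every characteristic, every residue field).  On the vertex
chart of `Bl_𝔪` the strict transform `z = u + q̃` of `V(f)` is TANGENT to the exceptional divisor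
along the cone (maximal contact migrates from `E` to `V(z)`), so the r2c tower does not apply; the
certificate is the companion `Q = Q₀ · 𝔪`, `Q₀ = A₀₂ A₁₀ A₁₁ A₁₂ (P + 𝔪²)` (`…ConeCubeCharts`),
whose total transform on the vertex blow-up is the five-step LETTER TOWER
`(c, w)(c, wG)(c, w²G)(c, w³G)(c, w³G²)` along the strict transforms `c` of `V(f)`, `w` of the new
and `G` of the cone (`…ConeCubeLevelTwo`, `…LetterTower`), and the two-letter tower on the side
charts (`…ConeCubeSide`).  PROVED here:

* `isRegular_of_isBlowup_cubeIQ_three` — the vertex chart (level two instantiated with `A = B₃`);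
* `isRegular_of_isBlowup_cubeIQM` — every blowing up of `Spec S` along `I · Q₀ · 𝔪` is regular;
* the rung: `companion_coneCube_sup_pow_four` (`(f) + 𝔪⁴ ∈ 𝒞`, companion `⊇ 𝔪¹⁹`),
  `coreRung_coneCube_sup_pow_four`, `coreRung_fourthPowersPlus_coneCube` (`(x₀⁴, …, x₃⁴, f)`),
  `…_of_ringKrullDim`, `atomDimFourBlowupAt_fourthPowersPlus_coneCube` (the registered core's binder
  shape restricted to the member).

So at depth two over the cone BOTH tilt classes are now kernel-checked: the weight-2-permissible
class `g ∈ P𝔪²` (`…ConeTiltFamily*`) and the contact-migration direction `x₃³`.  BC5-type FORMAT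
evidence; nothing here is a statement of the manuscript under review.

## References

* The Stacks Project, Tags 080A, 080B, 0804, 0BIQ. [StacksProject]
* Q. Liu, *Algebraic Geometry and Arithmetic Curves*, OUP 2002, Thm. 8.1.19 (a). [Liu2002]
* H. Matsumura, *Commutative Ring Theory*, CUP 1986, Thms. 14.2, 16.2. [Matsumura1987]
-/

-- `Summit.<Summit>.<Sub>.Theorems` with `Sub = Summit` (single-conjunct summit, D-0017)
set_option linter.dupNamespace false

noncomputable section

open CategoryTheory CategoryTheory.Limits AlgebraicGeometry Literature.AlgebraicGeometry.Resolution
open IsLocalRing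

namespace Summit.ResolutionOfSingularities.ResolutionOfSingularities.Theorems

namespace ConeRung

universe u

/-! ## Level one over a regular local base -/

section LevelOneRegular

variable {S : Type u} [CommRing S] [IsRegularLocalRing S] (x : Fin 4 → S)
  (hx : Ideal.span (Set.range x) = IsLocalRing.maximalIdeal S)
  (hd : (IsLocalRing.maximalIdeal S).spanFinrank = 4)

local notation3 "M" => Ideal.span (Set.range x)
local notation3 "PP" => Ideal.span {x 0, x 1, x 2}
local notation3 "fC" => x 0 * x 1 + x 2 ^ 2 + x 3 ^ 3
local notation3 "IC" => Ideal.span {x 0 * x 1 + x 2 ^ 2 + x 3 ^ 3} ⊔ Ideal.span (Set.range x) ^ 4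
/-- the companion `Q₀ = A₀₂ A₁₀ A₁₁ A₁₂ (P + 𝔪²)` -/
local notation3 "Q0" => (Ideal.span {x 0 * x 1 + x 2 ^ 2 + x 3 ^ 3} ⊔ (PP ⊔ M ^ 2) ^ 2) *
  (Ideal.span {x 0 * x 1 + x 2 ^ 2 + x 3 ^ 3} ⊔ M ^ 3) *
  (Ideal.span {x 0 * x 1 + x 2 ^ 2 + x 3 ^ 3} ⊔ M ^ 2 * (PP ⊔ M ^ 2)) *
  (Ideal.span {x 0 * x 1 + x 2 ^ 2 + x 3 ^ 3} ⊔ M * (PP ⊔ M ^ 2) ^ 2) * (PP ⊔ M ^ 2)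
/-- the vertex-chart family index `k ↦ castSucc k ≠ 3` -/
local notation3 "jJ3" =>
  (fun k : Fin 3 => (⟨Fin.castSucc k, castSucc_ne_three k⟩ : {j : Fin 4 // j ≠ 3}))

/-! ### The vertex chart `x₃`: instantiate level two with `A = B₃` -/

include hx hd in
/-- **The vertex chart: every blow-up of `Spec B₃` along `(I Q₀) B₃ = u¹¹ · Π · 𝔫₀` is regular** —
the abstract level two `isRegular_of_isBlowup_cubePi_mul_span` with `A = B₃`, `t = u`, `v_k = e_k`
(the cone surface `V(u, F) ⊂ B₃` integral and missing every `e_k`: `…ConeCubeVertexCone`).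
[cite: StacksProject, Tag 080A] [cite: Liu2002, Thm. 8.1.19 (a)] -/
theorem isRegular_of_isBlowup_cubeIQ_three {Y : Scheme.{u}}
    {ρ : Y ⟶ Spec (.of (chartRing x 3))}
    (hρ : IsBlowup ρ (affineBlowup.idealSheaf ((IC * Q0).map (chartBase x 3)))) :
    Scheme.IsRegular Y := by
  haveI : IsDomain S := isDomain_of_isRegularLocalRing S
  have hqr := isQuasiRegular_regularSystemOfParameters hd x hx
  haveI : IsRegularRing (chartRing x 3) := isRegularRing_chart x hx hd 3
  haveI := isRegularRing_residue x hx
  haveI := isDomain_residue x hx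
  have hx3 : x 3 ≠ 0 := (isRsopPart_comp_of_rsop hd x hx id Function.injective_id).ne_zero 3
  haveI : IsDomain (chartRing x 3) := isDomain_chartRing x 3 hx3
  haveI : IsRegularRing (chartRing x 3 ⧸ Ideal.span (Set.range
      (Fin.cons (chartBase x 3 (x 3)) (fun k : Fin 3 => chartGen x 3 (jJ3 k).1) :
        Fin 4 → chartRing x 3))) :=
    isRegularRing_quot_cons_chartGen x 3 jJ3 hqr
  haveI : IsDomain (chartRing x 3 ⧸ Ideal.span (Set.range
      (Fin.cons (chartBase x 3 (x 3)) (fun k : Fin 3 => chartGen x 3 (jJ3 k).1) :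
        Fin 4 → chartRing x 3))) :=
    isDomain_quot_span_range_cc x hx hd
  haveI : IsDomain (chartRing x 3 ⧸ Ideal.span {chartBase x 3 (x 3)}) :=
    isDomain_chartRing_quot_span x 3 hqr
  have hc : IsQuasiRegular (Fin.cons (chartBase x 3 (x 3))
      (fun k : Fin 3 => chartGen x 3 (jJ3 k).1) : Fin 4 → chartRing x 3) :=
    isQuasiRegular_cons_chartGen x 3 jJ3 hqr jJ3_injective
  have hv : ∀ k : Fin 3, chartGen x 3 (jJ3 k).1 ∉ Ideal.span {chartBase x 3 (x 3)} :=
    fun k => chartGen_notMem_span_u x hx hd 3 _ (castSucc_ne_three k)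
  have hFt := F_notMem_span_u x hx hd 3
  have hdF := isDomain_quot_span_u_F_three x hx hd
  have hvF : ∀ k : Fin 3, chartGen x 3 (jJ3 k).1 ∉ Ideal.span {chartBase x 3 (x 3),
      chartGen x 3 0 * chartGen x 3 1 + chartGen x 3 2 ^ 2} :=
    fun k => chartGen_notMem_span_u_F_three x hx hd k
  have hreg1 : ∀ (k : Fin 3) (P : Ideal (chartRing x 3 ⧸ Ideal.span {chartBase x 3 (x 3),
      chartGen x 3 0 * chartGen x 3 1 + chartGen x 3 2 ^ 2})) [P.IsPrime],
      Ideal.Quotient.mk _ (chartGen x 3 (Fin.castSucc k)) ∉ P →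
        IsRegularLocalRing (Localization.AtPrime P) :=
    fun k P _ hP => isRegularLocalRing_quot_span_u_F_three x hx hd P k hP
  have e1 : chartGen x 3 0 * chartGen x 3 1 + chartGen x 3 2 ^ 2 +
      chartBase x 3 (x 3) * chartGen x 3 3 ^ 3 =
      chartGen x 3 0 * chartGen x 3 1 + chartGen x 3 2 ^ 2 + chartBase x 3 (x 3) := by
    rw [show chartGen x 3 3 = 1 from chartGen_self x 3]
    ring
  rw [map_chartBase_cubeIQ x 3, e1] at hρ
  have hu11 : chartBase x 3 (x 3) ^ 11 ∈ nonZeroDivisors (chartRing x 3) :=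
    pow_mem (reesChartBase_mem_nonZeroDivisors (x 3)
      (Ideal.mem_span_range_self (f := x) (x := 3))) 11
  exact isRegular_of_isBlowup_span_singleton_mul_of_forall hu11 _
    (fun Y' ρ' h' => isRegular_of_isBlowup_cubePi_mul_span (chartBase x 3 (x 3))
      (fun k : Fin 3 => chartGen x 3 (jJ3 k).1) hc hdF hv hFt hvF hreg1 h') hρ

/-! ### Assembly over `Bl_𝔪` and the rung -/

include hx hd in
/-- **Every blowing up of `Spec S` along `I · Q₀ · 𝔪` is regular** — `Bl_𝔪` and the four charts
(`…ConeCubeSide` for `i ≤ 2`, the vertex chart above).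
[cite: StacksProject, Tag 080A] [cite: Liu2002, Thm. 8.1.19 (a)] -/
theorem isRegular_of_isBlowup_cubeIQM {Y : Scheme.{u}} {f : Y ⟶ Spec (.of S)}
    (hf : IsBlowup f (affineBlowup.idealSheaf ((IC * Q0) * M))) : Scheme.IsRegular Y := by
  refine isRegular_of_isBlowup_mul_of_charts x (IC * Q0) (fun i Y' ρ h => ?_) hf
  by_cases hi : i = 3
  · subst hi
    exact isRegular_of_isBlowup_cubeIQ_three x hx hd h
  · exact isRegular_of_isBlowup_cubeIQ_of_ne_three x hx hd i hi h

include hx in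
/-- `𝔪¹⁹ ≤ Q₀ · 𝔪`. [folklore] -/
theorem pow_le_cubeQ0_mul : IsLocalRing.maximalIdeal S ^ 19 ≤ Q0 * M := by
  rw [← hx, pow_succ]
  exact Ideal.mul_mono (cube_companion_bound x) le_rfl

include hx hd in
/-- **`I = (x₀x₁ + x₂² + x₃³) + 𝔪⁴` is in the companion class `𝒞`** with companion
`Q₀ · 𝔪 ⊇ 𝔪¹⁹`. [cite: StacksProject, Tag 080A] -/
theorem companion_coneCube_sup_pow_four :
    ∃ (Q : Ideal S) (m : ℕ), IsLocalRing.maximalIdeal S ^ m ≤ Q ∧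
      ∃ (Y : Scheme.{u}) (b : Y ⟶ Spec (.of S)),
        IsBlowup b (affineBlowup.idealSheaf ((IC) * Q)) ∧ Scheme.IsRegular Y := by
  obtain ⟨Y, b, hb⟩ := exists_isBlowup (Spec (.of S)) (affineBlowup.idealSheaf ((IC * Q0) * M))
  exact ⟨Q0 * M, 19, pow_le_cubeQ0_mul x hx, Y, b, by rwa [← mul_assoc],
    isRegular_of_isBlowup_cubeIQM x hx hd hb⟩

include hx hd in
/-- **CORE RUNG — the CONTACT-MIGRATION member.**  For `S` regular local with regular system of
parameters `x₀, …, x₃` and `I = (x₀x₁ + x₂² + x₃³) + 𝔪⁴`, every blowing up `T = Bl_I Spec S`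
carries a non-zero ideal sheaf cosupported in the closed fibre whose blowing up is regular.  Every
characteristic, every residue field. [cite: StacksProject, Tag 080A] [cite: Liu2002, Thm. 8.1.19 (a)] -/
theorem coreRung_coneCube_sup_pow_four (T : Scheme.{u}) (f : T ⟶ Spec (.of S))
    (hf : IsBlowup f (affineBlowup.idealSheaf
      (Ideal.span {x 0 * x 1 + x 2 ^ 2 + x 3 ^ 3} ⊔ IsLocalRing.maximalIdeal S ^ 4))) :
    ∃ (J : T.IdealSheafData) (T' : Scheme.{u}) (π : T' ⟶ T), J ≠ ⊥ ∧
      (∀ t : T, t ∈ J.support → f.base t = IsLocalRing.closedPoint S) ∧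
      IsBlowup π J ∧ Scheme.IsRegular T' := by
  haveI : IsDomain S := isDomain_of_isRegularLocalRing S
  have hx0 : x 0 ≠ 0 := (isRsopPart_comp_of_rsop hd x hx id Function.injective_id).ne_zero 0
  have h𝔪 : IsLocalRing.maximalIdeal S ≠ ⊥ := fun h => hx0 (by
    have := hx.le (Ideal.subset_span (Set.mem_range_self 0)); rw [h] at this
    exact (Submodule.mem_bot S).mp this)
  have hI : (IC) ≠ ⊥ := fun h => pow_ne_zero 4 h𝔪 (by
    rw [← hx]; exact eq_bot_iff.mpr (le_sup_right.trans h.le))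
  have hQ : IsLocalRing.maximalIdeal S ^ 18 ≤ Q0 := by rw [← hx]; exact cube_companion_bound x
  rw [← hx] at hf
  exact atomConclusion_of_pointBlowup_charts x hx h𝔪 hI hQ (fun i Y' ρ h => by
    by_cases hi : i = 3
    · subst hi
      exact isRegular_of_isBlowup_cubeIQ_three x hx hd h
    · exact isRegular_of_isBlowup_cubeIQ_of_ne_three x hx hd i hi h) T f hf

include hx hd in
/-- **The Frobenius-shaped variant `(x₀⁴, x₁⁴, x₂⁴, x₃⁴, x₀x₁ + x₂² + x₃³)`** — a sup-reduction of
`(f) + 𝔪⁴` (`(xᵢ⁴) · 𝔪¹² = 𝔪¹⁶`). [cite: StacksProject, Tag 080A] [cite: Liu2002, Thm. 8.1.19 (a)] -/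
theorem coreRung_fourthPowersPlus_coneCube (T : Scheme.{u}) (f : T ⟶ Spec (.of S))
    (hf : IsBlowup f (affineBlowup.idealSheaf
      (Ideal.span (Set.range (fun i : Fin 4 => x i ^ 4) ∪ {x 0 * x 1 + x 2 ^ 2 + x 3 ^ 3})))) :
    ∃ (J : T.IdealSheafData) (T' : Scheme.{u}) (π : T' ⟶ T), J ≠ ⊥ ∧
      (∀ t : T, t ∈ J.support → f.base t = IsLocalRing.closedPoint S) ∧
      IsBlowup π J ∧ Scheme.IsRegular T' := by
  haveI : IsDomain S := isDomain_of_isRegularLocalRing S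
  have hx0 : x 0 ≠ 0 := (isRsopPart_comp_of_rsop hd x hx id Function.injective_id).ne_zero 0
  -- the pigeonhole `(xᵢ⁴) · 𝔪¹² = 𝔪¹⁶`
  have hred :
      Ideal.span (Set.range fun i : Fin 4 => x i ^ 4) * (M ^ 4) ^ 3 = (M ^ 4) ^ (3 + 1) := by
    rw [← pow_mul, ← pow_mul, CoreRung.span_powers_mul_pow_eq_pow x rfl (by norm_num)]
  have hle : Ideal.span (Set.range fun i : Fin 4 => x i ^ 4) ≤ M ^ 4 := by
    rw [Ideal.span_le]
    rintro _ ⟨i, rfl⟩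
    exact Ideal.pow_mem_pow (Ideal.subset_span (Set.mem_range_self i)) 4
  have hI :
      Ideal.span {x 0 * x 1 + x 2 ^ 2 + x 3 ^ 3} ⊔
        Ideal.span (Set.range fun i : Fin 4 => x i ^ 4) ≠ ⊥ :=
    fun h => pow_ne_zero 4 hx0 ((Submodule.eq_bot_iff _).mp h _
      (Ideal.mem_sup_right (Ideal.subset_span
        (Set.mem_range_self (f := fun i : Fin 4 => x i ^ 4) 0))))
  have hKm : IsLocalRing.maximalIdeal S ^ 4 ≤ IC := by rw [← hx]; exact le_sup_right
  rw [Ideal.span_union, sup_comm] at hf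
  exact coreRung_sup_reduction_of_companion hle hred hI hKm (companion_coneCube_sup_pow_four x hx hd)
    T f hf

end LevelOneRegular

/-- **The `TargetR2pt` binder shape** (plan-1's `ChainW52TargetsC.lean`): dimension given as
`ringKrullDim S = 4` with a generating family `x` of length `4`.
[cite: StacksProject, Tag 080A] [cite: Liu2002, Thm. 8.1.19 (a)] -/
theorem coreRung_fourthPowersPlus_coneCube_of_ringKrullDim {S : Type u} [CommRing S]
    [IsRegularLocalRing S] (x : Fin 4 → S)
    (hx : Ideal.span (Set.range x) = IsLocalRing.maximalIdeal S)
    (hdim : ringKrullDim S = (4 : ℕ)) (T : Scheme.{u}) (f : T ⟶ Spec (.of S))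
    (hf : IsBlowup f (affineBlowup.idealSheaf
      (Ideal.span (Set.range (fun i : Fin 4 => x i ^ 4) ∪ {x 0 * x 1 + x 2 ^ 2 + x 3 ^ 3})))) :
    ∃ (J : T.IdealSheafData) (T' : Scheme.{u}) (π : T' ⟶ T), J ≠ ⊥ ∧
      (∀ t : T, t ∈ J.support → f.base t = IsLocalRing.closedPoint S) ∧
      IsBlowup π J ∧ Scheme.IsRegular T' := by
  have hd : (IsLocalRing.maximalIdeal S).spanFinrank = 4 := by
    have h := IsRegularLocalRing.spanFinrank_maximalIdeal (R := S)
    rw [hdim] at h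
    exact_mod_cast h
  exact coreRung_fourthPowersPlus_coneCube x hx hd T f hf

/-- **The same for `(f) + 𝔪⁴` in the `ringKrullDim` binder shape.** [cite: StacksProject, Tag 080A] -/
theorem coreRung_coneCube_sup_pow_four_of_ringKrullDim {S : Type u} [CommRing S]
    [IsRegularLocalRing S] (x : Fin 4 → S)
    (hx : Ideal.span (Set.range x) = IsLocalRing.maximalIdeal S)
    (hdim : ringKrullDim S = (4 : ℕ)) (T : Scheme.{u}) (f : T ⟶ Spec (.of S))
    (hf : IsBlowup f (affineBlowup.idealSheaf
      (Ideal.span {x 0 * x 1 + x 2 ^ 2 + x 3 ^ 3} ⊔ IsLocalRing.maximalIdeal S ^ 4))) :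
    ∃ (J : T.IdealSheafData) (T' : Scheme.{u}) (π : T' ⟶ T), J ≠ ⊥ ∧
      (∀ t : T, t ∈ J.support → f.base t = IsLocalRing.closedPoint S) ∧
      IsBlowup π J ∧ Scheme.IsRegular T' := by
  have hd : (IsLocalRing.maximalIdeal S).spanFinrank = 4 := by
    have h := IsRegularLocalRing.spanFinrank_maximalIdeal (R := S)
    rw [hdim] at h
    exact_mod_cast h
  exact coreRung_coneCube_sup_pow_four x hx hd T f hf

/-- **The registered core's binder shape, restricted to the member** (hypotheses of
`stub_atomDimFourBlowup`; characteristic, completeness, residue field and the off-fibre hypothesis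
unused). [cite: StacksProject, Tag 080A] [cite: Liu2002, Thm. 8.1.19 (a)] -/
theorem atomDimFourBlowupAt_fourthPowersPlus_coneCube (p : ℕ) (_hp : p.Prime) (S : Type) [CommRing S]
    [IsRegularLocalRing S] [CharP S p] [IsAdicComplete (IsLocalRing.maximalIdeal S) S]
    [PerfectField (IsLocalRing.ResidueField S)] (hS : ringKrullDim S = (4 : ℕ))
    (x : Fin 4 → S) (hx : Ideal.span (Set.range x) = IsLocalRing.maximalIdeal S)
    (T : Scheme.{0}) (f : T ⟶ Spec (.of S))
    (hf : IsBlowup f (affineBlowup.idealSheaf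
      (Ideal.span (Set.range (fun j : Fin 4 => x j ^ 4) ∪ {x 0 * x 1 + x 2 ^ 2 + x 3 ^ 3}))))
    (_hoff : ∀ t : T, f.base t ≠ IsLocalRing.closedPoint S →
      IsRegularLocalRing (T.presheaf.stalk t)) :
    ∃ (J : T.IdealSheafData) (T' : Scheme.{0}) (π : T' ⟶ T), J ≠ ⊥ ∧
      (∀ t : T, t ∈ J.support → f.base t = IsLocalRing.closedPoint S) ∧
      IsBlowup π J ∧ Scheme.IsRegular T' :=
  coreRung_fourthPowersPlus_coneCube_of_ringKrullDim x hx hS T f hf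

end ConeRung

end Summit.ResolutionOfSingularities.ResolutionOfSingularities.Theorems

end
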